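import Summits.HubbardSuperconductivity.HubbardSuperconductivity.Theorems.AnisotropyChordTransferFibre3FinXCCover

/-!
# Route `AnisotropyChord` / H0 rotor rung: FIN exact-block evaluator with the DIHEDRAL-REDUCED two-propagator table (XB-sym)

The per-`L` exact-block certificate `FinXB.xbCellOK` / `xbcCellOK` (…FinXBEval, …FinXCEval) spends almost all of its kernel time
in the two-propagator table `tTab`: `T(k) = Σ_p g(p) g(p − k)` for all `V = L²` momenta, `V²` interval products (67 s at `L = 15`,
∝ V²·L).  The cell table `g = gresCellTab L (cosTab L) la lb` is EXACTLY `D₄`-symmetric as a table of INTERVALS (`cosIv` folds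
`m ↦ L − m` by construction; `denCellIv` is symmetric in its two indices), and `iadd` is exact integer addition, so `T(k)` and
`T(σk)` are the same interval for every lattice symmetry `σ` — not merely enclosures of the same real number.  Hence the table
can be computed on the wedge `0 ≤ k₂ ≤ k₁ ≤ L/2` only (≈ V/8 entries) and filled in by symmetry, and the result is LITERALLY
EQUAL to `tTab`:
* `psum_fst/psum_snd` (componentwise sums), `sum_range_mirror` (re-indexing `i ↦ (L − i) mod L`);
* table symmetries `getF_gres_swap`, `getF_gres_mirror₁/₂`, `gAt_swap`, `gAt_mirror₁/₂`;
* `tEntry` (= `tTab`'s entry), `tEntry_swap`, `tEntry_mirror₁/₂`, `tEntry_fold`; the wedge table `tWedge`, ★ `tTabW`,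
  ★★ `tTabW_eq_tTab : tTabW L (gresCellTab …) = tTab L (gresCellTab …)`;
* ★ `xbEvalW`, `xbCellOKW`, `xbcCellOKW`, `xbCellAnyW`, `xbcCellAnyW` — the certificates with `tTabW` — and the program
  equivalences `xbEvalW_eq`, `xbCellOKW_eq`, `xbcCellOKW_eq`, ★★ `xbCellAnyW_eq`, ★★ `xbcCellAnyW_eq`: every soundness theorem of
  the XB/XC chain (`xb_cell_sound`, `xbc_cell_sound`, `trialGapAbs_of_check`, `offPoleTailAbs_of_xbcCheck`, …) is inherited —
  a kernel fact `xbcCellAnyW … = true` rewrites to `xbcCellAny … = true` at zero cost.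
Purpose: the FIN range `16 ≤ L ≲ 31` of the lead's ruling R1 (STATUS 2026-08-30 07:51Z), where the L-free `M₂ = 2` RExpr
program does not certify the `0.30` floor (p3 g5 FINDING 3, STATUS 08:48Z) and the unreduced table is too slow.
Prover seat `hubbard-h0-rotor-p3` g5; helper for piece A = stmt-HubbardSuperconductivity-23918 of rung 19089 (`--supports`, helper
class).  WHAT THIS IS NOT: nothing here proves superconductivity in the Hubbard model (rotor TARGET as worded stays FALSE, g15
verdict); a verified optimisation of the kernel evaluator of ONE conditional reduction.  Tree imports only; no sorry, no new axioms.
-/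

set_option linter.dupNamespace false
set_option autoImplicit false

namespace Summit.HubbardSuperconductivity.HubbardSuperconductivity.Theorems.AnisotropyChord.Transfer.Fibre3

namespace FinXB

open Finset Hole2 FinCell

/-! ## Componentwise sums and the mirror re-indexing -/

/-- the lower ends of a `psum` add up. [folklore] -/
theorem psum_fst (F : ℕ → Iv) (n : ℕ) : (psum F n).1 = ∑ i ∈ range n, (F i).1 := by
  induction n with
  | zero => rfl
  | succ n ih => rw [psum, iadd, sum_range_succ, ← ih]

/-- the upper ends of a `psum` add up. [folklore] -/
theorem psum_snd (F : ℕ → Iv) (n : ℕ) : (psum F n).2 = ∑ i ∈ range n, (F i).2 := by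
  induction n with
  | zero => rfl
  | succ n ih => rw [psum, iadd, sum_range_succ, ← ih]

/-- `psum` only depends on the summands below `n`. [folklore] -/
theorem psum_congr {F G : ℕ → Iv} {n : ℕ} (h : ∀ i, i < n → F i = G i) : psum F n = psum G n := by
  induction n with
  | zero => rfl
  | succ n ih =>
    rw [psum, psum, ih (fun i hi => h i (by omega)), h n (by omega)]

/-- two `psum`s with equal componentwise totals are equal. [folklore] -/
theorem psum_eq_of_sums {F G : ℕ → Iv} {n m : ℕ}
    (h1 : ∑ i ∈ range n, (F i).1 = ∑ i ∈ range m, (G i).1) (h2 : ∑ i ∈ range n, (F i).2 = ∑ i ∈ range m, (G i).2) :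
    psum F n = psum G m :=
  Prod.ext (by rw [psum_fst, psum_fst, h1]) (by rw [psum_snd, psum_snd, h2])

/-- re-indexing a `range L` sum by the mirror `i ↦ (L − i) mod L` (a bijection of `range L`). [folklore] -/
theorem sum_range_mirror {α : Type*} [AddCommMonoid α] (f : ℕ → α) {L : ℕ} (hL : 0 < L) :
    ∑ i ∈ range L, f ((L - i) % L) = ∑ i ∈ range L, f i := by
  obtain ⟨n, rfl⟩ : ∃ n, L = n + 1 := ⟨L - 1, by omega⟩
  rw [sum_range_succ' (fun i => f ((n + 1 - i) % (n + 1))), sum_range_succ' f]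
  have h0 : (n + 1 - 0) % (n + 1) = 0 := by simp
  rw [h0]
  congr 1
  have h1 : ∀ i ∈ range n, f ((n + 1 - (i + 1)) % (n + 1)) = (fun j => f (j + 1)) (n - 1 - i) := by
    intro i hi
    rw [mem_range] at hi
    have : (n + 1 - (i + 1)) % (n + 1) = n - 1 - i + 1 := by
      rw [Nat.mod_eq_of_lt (by omega)]; omega
    simp only [this]
  rw [sum_congr rfl h1, sum_range_reflect (fun j => f (j + 1)) n]

/-! ## The cell table `g` is exactly `D₄`-symmetric -/

/-- the mirror index is again below `L`. [folklore] -/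
theorem mirror_lt {L i : ℕ} (hL : 0 < L) : (L - i) % L < L := Nat.mod_lt _ hL

/-- the mirror index vanishes iff the index does (`i < L`). [folklore] -/
theorem mirror_eq_zero_iff {L i : ℕ} (hi : i < L) : (L - i) % L = 0 ↔ i = 0 := by
  constructor
  · intro h
    by_contra hne
    rw [Nat.mod_eq_of_lt (by omega)] at h
    omega
  · rintro rfl; simp

/-- `cosIv` is mirror-symmetric by construction. [folklore] -/
theorem cosIv_mirror {L i : ℕ} (hi : i < L) : cosIv L ((L - i) % L) = cosIv L i := by
  rcases Nat.eq_zero_or_pos i with rfl | hi0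
  · simp
  · have hm : (L - i) % L = L - i := Nat.mod_eq_of_lt (by omega)
    rw [hm]
    have hfold : (if 2 * (L - i) ≤ L then L - i else L - (L - i)) = (if 2 * i ≤ L then i else L - i) := by
      split_ifs <;> omega
    unfold cosIv
    rw [if_neg (show ¬ (L - i = 0) by omega), if_neg (show ¬ (i = 0) by omega), hfold]

/-- entries of the cell table. [folklore] -/
theorem getF_gresCellTab {L : ℕ} (ct : List Iv) (la lb : ℤ) {i j : ℕ} (hi : i < L) (hj : j < L) :
    getF (gresCellTab L ct la lb) i j = iinv (denCellIv ct la lb i j) := by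
  unfold getF gresCellTab
  exact getIv_tab _ hi hj

/-- `denCellIv` is symmetric in its two indices. [folklore] -/
theorem denCellIv_swap (ct : List Iv) (la lb : ℤ) (i j : ℕ) : denCellIv ct la lb i j = denCellIv ct la lb j i := by
  unfold denCellIv
  ext <;> ring

/-- `denCellIv` on the cosine table is mirror-symmetric in the first index. [folklore] -/
theorem denCellIv_mirror₁ {L : ℕ} (la lb : ℤ) {i : ℕ} (hi : i < L) (j : ℕ) :
    denCellIv (cosTab L) la lb ((L - i) % L) j = denCellIv (cosTab L) la lb i j := by
  unfold denCellIv
  rw [getIv_cosTab (mirror_lt (by omega)), getIv_cosTab hi, cosIv_mirror hi]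

/-- swap symmetry of the cell table. [folklore] -/
theorem getF_gres_swap {L : ℕ} (la lb : ℤ) {i j : ℕ} (hi : i < L) (hj : j < L) :
    getF (gresCellTab L (cosTab L) la lb) i j = getF (gresCellTab L (cosTab L) la lb) j i := by
  rw [getF_gresCellTab _ _ _ hi hj, getF_gresCellTab _ _ _ hj hi, denCellIv_swap]

/-- mirror symmetry of the cell table in the first index. [folklore] -/
theorem getF_gres_mirror₁ {L : ℕ} (la lb : ℤ) {i j : ℕ} (hi : i < L) (hj : j < L) :
    getF (gresCellTab L (cosTab L) la lb) ((L - i) % L) j = getF (gresCellTab L (cosTab L) la lb) i j := by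
  rw [getF_gresCellTab _ _ _ (mirror_lt (by omega)) hj, getF_gresCellTab _ _ _ hi hj, denCellIv_mirror₁ la lb hi]

/-- mirror symmetry of the cell table in the second index. [folklore] -/
theorem getF_gres_mirror₂ {L : ℕ} (la lb : ℤ) {i j : ℕ} (hi : i < L) (hj : j < L) :
    getF (gresCellTab L (cosTab L) la lb) i ((L - j) % L) = getF (gresCellTab L (cosTab L) la lb) i j := by
  rw [← getF_gres_swap la lb (mirror_lt (by omega)) hi, getF_gres_mirror₁ la lb hj hi, getF_gres_swap la lb hj hi]

/-- swap symmetry of `gAt`. [folklore] -/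
theorem gAt_swap {L : ℕ} (la lb : ℤ) {i j : ℕ} (hi : i < L) (hj : j < L) :
    gAt (gresCellTab L (cosTab L) la lb) i j = gAt (gresCellTab L (cosTab L) la lb) j i := by
  unfold gAt
  rw [getF_gres_swap la lb hi hj]
  by_cases h : i = 0 ∧ j = 0
  · rw [if_pos h, if_pos ⟨h.2, h.1⟩]
  · rw [if_neg h, if_neg (fun h' => h ⟨h'.2, h'.1⟩)]

/-- mirror symmetry of `gAt` in the first index. [folklore] -/
theorem gAt_mirror₁ {L : ℕ} (la lb : ℤ) {i j : ℕ} (hi : i < L) (hj : j < L) :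
    gAt (gresCellTab L (cosTab L) la lb) ((L - i) % L) j = gAt (gresCellTab L (cosTab L) la lb) i j := by
  unfold gAt
  rw [getF_gres_mirror₁ la lb hi hj]
  simp only [mirror_eq_zero_iff hi]

/-- mirror symmetry of `gAt` in the second index. [folklore] -/
theorem gAt_mirror₂ {L : ℕ} (la lb : ℤ) {i j : ℕ} (hi : i < L) (hj : j < L) :
    gAt (gresCellTab L (cosTab L) la lb) i ((L - j) % L) = gAt (gresCellTab L (cosTab L) la lb) i j := by
  unfold gAt
  rw [getF_gres_mirror₂ la lb hi hj]
  simp only [mirror_eq_zero_iff hj]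

/-! ## The `T`-entry and its symmetries -/

/-- the entry of `tTab` at natural coordinates `(k₁, k₂)` (verbatim its summand). -/
def tEntry (L : ℕ) (gt : List (List Iv)) (k1 k2 : ℕ) : Iv :=
  psum (fun p1 => psum (fun p2 =>
    imul (gAt gt p1 p2) (gAt gt (modNat L ((p1 : ℤ) - k1)) (modNat L ((p2 : ℤ) - k2)))) L) L

/-- `tTab` tabulates `tEntry`. [folklore] -/
theorem getF_tTab {L : ℕ} (gt : List (List Iv)) {k1 k2 : ℕ} (hk1 : k1 < L) (hk2 : k2 < L) :
    getF (tTab L gt) k1 k2 = tEntry L gt k1 k2 := by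
  unfold tTab tEntry
  exact getF_mkTab _ hk1 hk2

/-- the shifted index under the mirror: `((L − p) mod L − (L − k) mod L) mod L = (L − (p − k) mod L) mod L`. [folklore] -/
theorem modNat_mirror {L : ℕ} (hL : 0 < L) {p k : ℕ} (hp : p < L) (hk : k < L) :
    modNat L ((((L - p) % L : ℕ) : ℤ) - (((L - k) % L : ℕ) : ℤ)) = (L - modNat L ((p : ℤ) - k)) % L := by
  have h1 := modNat_lt L hL ((((L - p) % L : ℕ) : ℤ) - (((L - k) % L : ℕ) : ℤ))
  have h2 : (L - modNat L ((p : ℤ) - k)) % L < L := Nat.mod_lt _ hL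
  have hc : ((modNat L ((((L - p) % L : ℕ) : ℤ) - (((L - k) % L : ℕ) : ℤ)) : ℕ) : ZMod L)
      = (((L - modNat L ((p : ℤ) - k)) % L : ℕ) : ZMod L) := by
    have hm := modNat_lt L hL ((p : ℤ) - k)
    rw [modNat_cast L hL, ZMod.natCast_mod, Nat.cast_sub (le_of_lt hm), Int.cast_sub, Int.cast_natCast, Int.cast_natCast,
      ZMod.natCast_mod, ZMod.natCast_mod, modNat_cast L hL, Nat.cast_sub (le_of_lt hp), Nat.cast_sub (le_of_lt hk),
      ZMod.natCast_self, Int.cast_sub, Int.cast_natCast, Int.cast_natCast]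
    ring
  have := (ZMod.natCast_eq_natCast_iff' _ _ L).1 hc
  rwa [Nat.mod_eq_of_lt h1, Nat.mod_eq_of_lt h2] at this

/-- swap symmetry of the `T`-entry. [folklore] -/
theorem tEntry_swap {L : ℕ} (hL : 0 < L) (la lb : ℤ) (k1 k2 : ℕ) :
    tEntry L (gresCellTab L (cosTab L) la lb) k1 k2 = tEntry L (gresCellTab L (cosTab L) la lb) k2 k1 := by
  set gt := gresCellTab L (cosTab L) la lb with hgt
  have key : ∀ p1 p2, p1 < L → p2 < L →
      imul (gAt gt p1 p2) (gAt gt (modNat L ((p1 : ℤ) - k1)) (modNat L ((p2 : ℤ) - k2)))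
        = imul (gAt gt p2 p1) (gAt gt (modNat L ((p2 : ℤ) - k2)) (modNat L ((p1 : ℤ) - k1))) := by
    intro p1 p2 hp1 hp2
    rw [gAt_swap la lb hp1 hp2, gAt_swap la lb (modNat_lt L hL _) (modNat_lt L hL _)]
  unfold tEntry
  apply psum_eq_of_sums
  · simp only [psum_fst]
    rw [sum_comm]
    exact sum_congr rfl fun p1 hp1 => sum_congr rfl fun p2 hp2 => by
      rw [key p2 p1 (mem_range.1 hp2) (mem_range.1 hp1)]
  · simp only [psum_snd]
    rw [sum_comm]
    exact sum_congr rfl fun p1 hp1 => sum_congr rfl fun p2 hp2 => by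
      rw [key p2 p1 (mem_range.1 hp2) (mem_range.1 hp1)]

/-- mirror symmetry of the `T`-entry in the first index. [folklore] -/
theorem tEntry_mirror₁ {L : ℕ} (hL : 0 < L) (la lb : ℤ) {k1 : ℕ} (k2 : ℕ) (hk1 : k1 < L) :
    tEntry L (gresCellTab L (cosTab L) la lb) ((L - k1) % L) k2 = tEntry L (gresCellTab L (cosTab L) la lb) k1 k2 := by
  set gt := gresCellTab L (cosTab L) la lb with hgt
  -- the summand at the mirrored `p₁` for the mirrored `k₁` is the summand at `p₁` for `k₁`
  have key : ∀ p1 p2, p1 < L → p2 < L →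
      imul (gAt gt ((L - p1) % L) p2) (gAt gt (modNat L ((((L - p1) % L : ℕ) : ℤ) - (((L - k1) % L : ℕ) : ℤ)))
        (modNat L ((p2 : ℤ) - k2)))
        = imul (gAt gt p1 p2) (gAt gt (modNat L ((p1 : ℤ) - k1)) (modNat L ((p2 : ℤ) - k2))) := by
    intro p1 p2 hp1 hp2
    rw [gAt_mirror₁ la lb hp1 hp2, modNat_mirror hL hp1 hk1, gAt_mirror₁ la lb (modNat_lt L hL _) (modNat_lt L hL _)]
  unfold tEntry
  apply psum_eq_of_sums
  · simp only [psum_fst]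
    rw [← sum_range_mirror (fun p1 => ∑ p2 ∈ range L,
      (imul (gAt gt p1 p2) (gAt gt (modNat L ((p1 : ℤ) - (((L - k1) % L : ℕ) : ℤ))) (modNat L ((p2 : ℤ) - k2)))).1) hL]
    exact sum_congr rfl fun p1 hp1 => sum_congr rfl fun p2 hp2 => by
      rw [key p1 p2 (mem_range.1 hp1) (mem_range.1 hp2)]
  · simp only [psum_snd]
    rw [← sum_range_mirror (fun p1 => ∑ p2 ∈ range L,
      (imul (gAt gt p1 p2) (gAt gt (modNat L ((p1 : ℤ) - (((L - k1) % L : ℕ) : ℤ))) (modNat L ((p2 : ℤ) - k2)))).2) hL]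
    exact sum_congr rfl fun p1 hp1 => sum_congr rfl fun p2 hp2 => by
      rw [key p1 p2 (mem_range.1 hp1) (mem_range.1 hp2)]

/-- mirror symmetry of the `T`-entry in the second index. [folklore] -/
theorem tEntry_mirror₂ {L : ℕ} (hL : 0 < L) (la lb : ℤ) (k1 : ℕ) {k2 : ℕ} (hk2 : k2 < L) :
    tEntry L (gresCellTab L (cosTab L) la lb) k1 ((L - k2) % L) = tEntry L (gresCellTab L (cosTab L) la lb) k1 k2 := by
  rw [tEntry_swap hL la lb k1 ((L - k2) % L), tEntry_mirror₁ hL la lb k1 hk2, tEntry_swap hL la lb k2 k1]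

/-- the folded index `k ↦ min(k, L − k)` (natural representative of `±k` in `[0, L/2]`). -/
def fold (L k : ℕ) : ℕ := if 2 * k ≤ L then k else L - k

/-- the folded index is at most `L/2`. [folklore] -/
theorem fold_le {L k : ℕ} (hk : k < L) : fold L k ≤ L / 2 := by
  unfold fold; split_ifs <;> omega

/-- folding does not change the `T`-entry. [folklore] -/
theorem tEntry_fold {L : ℕ} (hL : 0 < L) (la lb : ℤ) {k1 k2 : ℕ} (hk1 : k1 < L) (hk2 : k2 < L) :
    tEntry L (gresCellTab L (cosTab L) la lb) (fold L k1) (fold L k2) = tEntry L (gresCellTab L (cosTab L) la lb) k1 k2 := by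
  have h1 : tEntry L (gresCellTab L (cosTab L) la lb) (fold L k1) k2 = tEntry L (gresCellTab L (cosTab L) la lb) k1 k2 := by
    unfold fold
    split_ifs with h
    · rfl
    · have : L - k1 = (L - k1) % L := (Nat.mod_eq_of_lt (by omega)).symm
      rw [this, tEntry_mirror₁ hL la lb k2 hk1]
  rw [← h1]
  unfold fold
  split_ifs with ha hb hb
  · rfl
  · have : L - k2 = (L - k2) % L := (Nat.mod_eq_of_lt (by omega)).symm
    rw [this, tEntry_mirror₂ hL la lb k1 hk2]
  · rfl
  · have : L - k2 = (L - k2) % L := (Nat.mod_eq_of_lt (by omega)).symm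
    rw [this, tEntry_mirror₂ hL la lb _ hk2]

/-! ## The wedge table and the symmetric table -/

/-- the honest `T`-entries on the wedge `0 ≤ r₂ ≤ r₁ ≤ L/2` (row `r₁` has `r₁ + 1` entries). -/
def tWedge (L : ℕ) (gt : List (List Iv)) : List (List Iv) :=
  (List.range (L / 2 + 1)).map fun r1 => (List.range (r1 + 1)).map fun r2 => tEntry L gt r1 r2

/-- ★ the two-propagator table filled from the wedge by the lattice symmetries (≈ V/8 honest entries). -/
def tTabW (L : ℕ) (gt : List (List Iv)) : List (List Iv) :=
  let W := tWedge L gt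
  mkTab L fun k1 k2 => getF W (max (fold L k1) (fold L k2)) (min (fold L k1) (fold L k2))

/-- entries of the wedge table. [folklore] -/
theorem getF_tWedge {L : ℕ} (gt : List (List Iv)) {r1 r2 : ℕ} (hr1 : r1 ≤ L / 2) (hr2 : r2 ≤ r1) :
    getF (tWedge L gt) r1 r2 = tEntry L gt r1 r2 := by
  unfold getF tWedge getIv
  rw [getD_map_range _ _ (by omega), getD_map_range _ _ (by omega)]

/-- ★★ **THE SYMMETRIC TABLE IS THE FULL TABLE** (as intervals, on the cell table of any λ-cell). [folklore] -/
theorem tTabW_eq_tTab (L : ℕ) (la lb : ℤ) :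
    tTabW L (gresCellTab L (cosTab L) la lb) = tTab L (gresCellTab L (cosTab L) la lb) := by
  rcases Nat.eq_zero_or_pos L with rfl | hL
  · rfl
  unfold tTabW tTab mkTab
  apply List.map_congr_left
  intro k1 hk1
  rw [List.mem_range] at hk1
  apply List.map_congr_left
  intro k2 hk2
  rw [List.mem_range] at hk2
  change getF (tWedge L _) _ _ = tEntry L _ k1 k2
  rw [← tEntry_fold hL la lb hk1 hk2]
  have ha := fold_le hk1
  have hb := fold_le hk2
  rcases le_total (fold L k2) (fold L k1) with h | h
  · rw [max_eq_left h, min_eq_right h, getF_tWedge _ ha h]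
  · rw [max_eq_right h, min_eq_left h, getF_tWedge _ hb h,
      tEntry_swap hL la lb]

/-! ## The certificates with the symmetric table, and the program equivalences -/

/-- ★ the exact-block evaluation with the symmetric table. -/
def xbEvalW (L : ℕ) (la lb : ℤ) : XBScal × XBObj :=
  let gt := gresCellTab L (cosTab L) la lb
  let S := xbScal L la lb gt
  let tt := tTabW L gt
  (S, xbObj L S gt tt (cosTab L) (cosTab (4 * L)))

/-- program equivalence: `xbEvalW = xbEval`. [folklore] -/
theorem xbEvalW_eq (L : ℕ) (la lb : ℤ) : xbEvalW L la lb = xbEval L la lb := by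
  unfold xbEvalW xbEval
  simp only [tTabW_eq_tTab]

/-- ★ the row-`N₁` cell certificate with the symmetric table (cf. `xbCellOK`). -/
def xbCellOKW (L : ℕ) (la lb : ℤ) (cmin : ℚ) : Bool :=
  let E := xbEvalW L la lb
  groundCellCheck L la lb && xbScalOK L la lb && decide (0 < E.2.P.1) && decide (0 ≤ cmin) &&
    decide (cmin * (((3 * ((L : ℤ) * L) ^ 2 * tPlusHi E.1 E.2 : ℤ)) : ℚ) ≤ ((n1Lo E.1 E.2 : ℤ) : ℚ))

/-- program equivalence: `xbCellOKW = xbCellOK`. [folklore] -/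
theorem xbCellOKW_eq (L : ℕ) (la lb : ℤ) (cmin : ℚ) : xbCellOKW L la lb cmin = xbCellOK L la lb cmin := by
  unfold xbCellOKW xbCellOK
  rw [xbEvalW_eq]

/-- ★ the combined (rows `N₁` + C) cell certificate with the symmetric table (cf. `xbcCellOK`). -/
def xbcCellOKW (L : ℕ) (la lb : ℤ) (c : ℚ) (bn bd : ℕ) : Bool :=
  let E := xbEvalW L la lb
  let C := xcObj L la lb E.1 E.2
  (groundCellCheck L la lb && xbScalOK L la lb && decide (0 < E.2.P.1) && decide (0 ≤ c) &&
    decide (c * (((3 * ((L : ℤ) * L) ^ 2 * tPlusHi E.1 E.2 : ℤ)) : ℚ) ≤ ((n1Lo E.1 E.2 : ℤ) : ℚ))) &&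
  (decide (0 < bd) && xcMok L (fTab4 L la lb) C.M && decide (0 ≤ C.tlo) && decide (C.thi ≤ 2 * E.1.eps1.1) &&
    decide (0 ≤ C.eta.1) && decide (sqSum C ≤ rhsLo L E.1 C bn bd))

/-- program equivalence: `xbcCellOKW = xbcCellOK`. [folklore] -/
theorem xbcCellOKW_eq (L : ℕ) (la lb : ℤ) (c : ℚ) (bn bd : ℕ) : xbcCellOKW L la lb c bn bd = xbcCellOK L la lb c bn bd := by
  unfold xbcCellOKW xbcCellOK
  rw [xbEvalW_eq]

/-- ★ the row-`N₁` cell test of the cover with the symmetric table (cf. `xbCellAny`). -/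
def xbCellAnyW (L : ℕ) (d1 : ℚ) (la lb : ℤ) (c : ℚ) : Bool :=
  (denCellPos L (cosTab L) la lb && decide ((numIv L la lb).2 < 0) && decide (0 ≤ (G0Iv L la lb).1)) ||
  (groundCellCheck L la lb &&
    (decide ((deltaIv L la lb).2 < 0) || decide (d1 * (D : ℚ) < (((deltaIv L la lb).1 : ℤ) : ℚ)))) ||
  xbCellOKW L la lb c

/-- ★★ program equivalence: `xbCellAnyW = xbCellAny` — a kernel fact `xbCellAnyW … = true` is a cell fact of `…FinXBCover`. [folklore] -/
theorem xbCellAnyW_eq (L : ℕ) (d1 : ℚ) (la lb : ℤ) (c : ℚ) : xbCellAnyW L d1 la lb c = xbCellAny L d1 la lb c := by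
  unfold xbCellAnyW xbCellAny
  rw [xbCellOKW_eq]

/-- ★ the combined cell test of the cover with the symmetric table (cf. `xbcCellAny`). -/
def xbcCellAnyW (L : ℕ) (d1 : ℚ) (bd : ℕ) (la lb : ℤ) (cb : ℚ × ℕ) : Bool :=
  (denCellPos L (cosTab L) la lb && decide ((numIv L la lb).2 < 0) && decide (0 ≤ (G0Iv L la lb).1)) ||
  (groundCellCheck L la lb &&
    (decide ((deltaIv L la lb).2 < 0) || decide (d1 * (D : ℚ) < (((deltaIv L la lb).1 : ℤ) : ℚ)))) ||
  xbcCellOKW L la lb cb.1 cb.2 bd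

/-- ★★ program equivalence: `xbcCellAnyW = xbcCellAny` — a kernel fact `xbcCellAnyW … = true` is a cell fact of `…FinXCCover`. [folklore] -/
theorem xbcCellAnyW_eq (L : ℕ) (d1 : ℚ) (bd : ℕ) (la lb : ℤ) (cb : ℚ × ℕ) :
    xbcCellAnyW L d1 bd la lb cb = xbcCellAny L d1 bd la lb cb := by
  unfold xbcCellAnyW xbcCellAny
  rw [xbcCellOKW_eq]

end FinXB

end Summit.HubbardSuperconductivity.HubbardSuperconductivity.Theorems.AnisotropyChord.Transfer.Fibre3
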